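import Literature.Computability.Complexity.KKLTheorem
import HarnessLib

/-!
# The Nisan–Szegedy junta theorem (proved): a Boolean function of degree `d` depends on at most
# `d · 2^{d−1}` coordinates; the Schwartz–Zippel lemma on the cube

Source: N. Nisan, M. Szegedy, *On the degree of Boolean functions as real polynomials*, Comput.
Complexity 4 (1994) 301–313 [NisanSzegedy1994], as restated (with the proof) in J. Chiarelli,
P. Hatami, M. Saks, *An asymptotically tight bound on the number of relevant variables in a bounded
degree Boolean function*, arXiv:1801.08564 [ChiarelliHatamiSaks2018] (held text
`paper:arxiv-1801.08564`, §1 p0003): "Nisan and Szegedy [NS94], proved that `R(f)` is at most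
`deg(f)·2^{deg(f)−1}`" … "This bound was proved by observing that every degree `d` Boolean function
has total influence bounded by `d` while it can be seen via the Schwartz–Zippel lemma applied to the
derivative of a Boolean function at each direction `e_i` that each relevant variable has individual
influence at least `2^{−(d−1)}`."

SETTING: the tree's cube Fourier vocabulary (`Literature.Computability.Complexity.LowDegree`): real
functions on `{0,1}^m`, `cubeFourierCoeff`, `walsh`, `IsLevelLE d g` ("degree `≤ d`": `ĝ(S) = 0` for
`|S| > d`), `KKL.coordDeriv`, `KKL.influence` (`Inf_i[f] = Pr[f(x) ≠ f(x^{⊕i})]`),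
`KKL.totalInfluence`; the split along the first coordinate `g(b,y) = a(y) + χ(b) e(y)` of
`BonamiLevelK.lean` (`halfSum`, `halfDiff`).

* `two_pow_le_card_support` — **Schwartz–Zippel on the cube**: a nonzero `g` of degree `≤ e` is
  nonzero on at least `2^{m−e}` points (induction on `m` along the first coordinate).
* `influence_ge_of_isLevelLE` — every coordinate with nonzero influence on a `±1`-valued `f` of degree
  `≤ d` has influence `≥ 2^{−(d−1)}` (`D_i f` is nonzero of degree `≤ d − 1`).
* `totalInfluence_le_degree` — `I[f] = Σ_S |S| f̂(S)² ≤ d`.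
* `card_relevant_le` — at most `d·2^{d−1}` coordinates have nonzero influence, and
  `eq_of_agree_on_relevant` — `f` depends only on them: **the Nisan–Szegedy theorem**
  (`nisanSzegedy_junta`).

Consumers: the junta facts on the slice typed in
`Literature/Combinatorics/AssociationSchemes/SliceKindlerSafra.lean` (`FilmusIhringer2019_thm11`,
`Filmus2023_thm1`) quantify over Nisan–Szegedy's bound `γ(d) ≤ d·2^{d−1}`. No named facts here.

## References
* [NisanSzegedy1994] N. Nisan, M. Szegedy, Comput. Complexity 4 (1994) 301–313.
* [ChiarelliHatamiSaks2018] J. Chiarelli, P. Hatami, M. Saks, arXiv:1801.08564, §1 (p. 3).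
* [ODonnell2014] R. O'Donnell, *Analysis of Boolean Functions*, CUP 2014, §2.2 (derivatives,
  influences), §9.1 (restriction along a coordinate).
-/

noncomputable section

namespace Literature.Computability.Complexity.LowDegree

open Finset Literature.Probability.RandomGraphs.LowDegree
open scoped BigOperators

namespace NisanSzegedy

variable {m : ℕ}

/-! ### §1 Schwartz–Zippel on the cube -/

/-- The number of points where `g ≠ 0`, as a real number. [cite: ChiarelliHatamiSaks2018, §1 (p0003, "Schwartz–Zippel lemma applied to the derivative")] -/
def supportCount (g : (Fin m → Bool) → ℝ) : ℝ := ∑ x, if g x ≠ 0 then (1 : ℝ) else 0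

/-- `supportCount ≥ 0`. [cite: ChiarelliHatamiSaks2018, §1 (p0003)] -/
theorem supportCount_nonneg (g : (Fin m → Bool) → ℝ) : 0 ≤ supportCount g :=
  sum_nonneg fun _ _ => by split_ifs <;> norm_num

/-- The even part `a = halfSum g` has degree `≤ e` if `g` has. [cite: ODonnell2014, §9.1 (g(b,y) = a(y) + χ(b)e(y), deg a ≤ d)] -/
theorem isLevelLE_halfSum {e : ℕ} {g : (Fin (m + 1) → Bool) → ℝ} (hg : IsLevelLE e g) :
    IsLevelLE e (halfSum g) := by
  intro T hT
  rw [cubeFourierCoeff_halfSum]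
  exact hg _ (by rwa [card_map])

/-- The odd part `e = halfDiff g` has degree `≤ e − 1` if `g` has degree `≤ e` (and is zero if
`e = 0`). [cite: ODonnell2014, §9.1 (deg e ≤ d − 1)] -/
theorem cubeFourierCoeff_halfDiff_eq_zero {e : ℕ} {g : (Fin (m + 1) → Bool) → ℝ} (hg : IsLevelLE e g)
    (T : Finset (Fin m)) (hT : e < T.card + 1) : cubeFourierCoeff (halfDiff g) T = 0 := by
  rw [cubeFourierCoeff_halfDiff]
  exact hg _ (by rwa [card_insert_zero_map_succEmb])

/-- Splitting the support count along the first coordinate. [cite: ODonnell2014, §9.1] -/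
theorem supportCount_succ (g : (Fin (m + 1) → Bool) → ℝ) :
    supportCount g = ∑ y : Fin m → Bool,
      ((if g (Fin.cons false y) ≠ 0 then (1 : ℝ) else 0) +
        (if g (Fin.cons true y) ≠ 0 then (1 : ℝ) else 0)) := by
  unfold supportCount
  rw [sum_cube_succ]

/-- **Schwartz–Zippel on the cube**: a nonzero function of degree `≤ e` on `{0,1}^m` is nonzero on at
least a `2^{−e}` fraction of the points: `2^m ≤ 2^e · |{x : g(x) ≠ 0}|`. Induction on `m` along the
first coordinate: `g(b,y) = a(y) + χ(b)e(y)`; if `e ≡ 0` apply the hypothesis to `a` (degree `≤ e`),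
else to `e` (degree `≤ e−1`), noting that `a(y) ± e(y)` cannot both vanish when `e(y) ≠ 0`.
[cite: ChiarelliHatamiSaks2018, §1 (p0003, "via the Schwartz–Zippel lemma … influence at least 2^{−(d−1)}")] -/
theorem two_pow_le_card_support : ∀ {m : ℕ} (e : ℕ) (g : (Fin m → Bool) → ℝ), IsLevelLE e g →
    (∃ x, g x ≠ 0) → (2 : ℝ) ^ m ≤ 2 ^ e * supportCount g := by
  intro m
  induction m with
  | zero =>
    intro e g _ hne
    obtain ⟨x, hx⟩ := hne
    have h1 : (1 : ℝ) ≤ supportCount g := by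
      unfold supportCount
      calc (1 : ℝ) = (if g x ≠ 0 then (1 : ℝ) else 0) := (if_pos hx).symm
        _ ≤ ∑ x, (if g x ≠ 0 then (1 : ℝ) else 0) :=
          single_le_sum (f := fun x => if g x ≠ 0 then (1 : ℝ) else 0)
            (fun _ _ => by split_ifs <;> norm_num) (mem_univ x)
    have h2 : (1 : ℝ) ≤ 2 ^ e := one_le_pow₀ (by norm_num)
    rw [pow_zero]
    nlinarith
  | succ m ih =>
    intro e g hg hne
    by_cases hb : ∃ y, halfDiff g y ≠ 0
    · -- the odd part is nonzero: `e ≥ 1`, `deg (halfDiff g) ≤ e − 1`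
      have he : 1 ≤ e := by
        by_contra h0
        push Not at h0
        have h0' : e = 0 := by omega
        obtain ⟨y, hy⟩ := hb
        apply hy
        refine eq_zero_of_cubeFourierCoeff_eq_zero _ (fun T => ?_) y
        exact cubeFourierCoeff_halfDiff_eq_zero hg T (by omega)
      have hdeg : IsLevelLE (e - 1) (halfDiff g) := fun T hT =>
        cubeFourierCoeff_halfDiff_eq_zero hg T (by omega)
      have hih := ih (e - 1) (halfDiff g) hdeg hb
      -- pointwise: `[e(y) ≠ 0] ≤ [g(0,y) ≠ 0] + [g(1,y) ≠ 0]`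
      have hpt : ∀ y : Fin m → Bool, (if halfDiff g y ≠ 0 then (1 : ℝ) else 0) ≤
          (if g (Fin.cons false y) ≠ 0 then (1 : ℝ) else 0) +
            (if g (Fin.cons true y) ≠ 0 then (1 : ℝ) else 0) := by
        intro y
        by_cases hy : halfDiff g y ≠ 0
        · rw [if_pos hy]
          by_cases h0 : g (Fin.cons false y) ≠ 0
          · rw [if_pos h0]; split_ifs <;> norm_num
          · have h1 : g (Fin.cons true y) ≠ 0 := by
              intro h1
              apply hy
              unfold halfDiff
              rw [not_not.1 h0, h1]; norm_num
            rw [if_neg h0, if_pos h1]; norm_num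
        · rw [if_neg hy]; positivity
      have hsum : supportCount (halfDiff g) ≤ supportCount g := by
        rw [supportCount_succ]
        exact sum_le_sum fun y _ => hpt y
      have h2e : (2 : ℝ) ^ e = 2 * 2 ^ (e - 1) := by
        rw [← pow_succ']; congr 1; omega
      rw [pow_succ, h2e]
      have := mul_le_mul_of_nonneg_left hsum (by positivity : (0 : ℝ) ≤ 2 ^ (e - 1))
      linarith
    · -- the odd part vanishes: `g(b,y) = a(y)`
      push Not at hb
      have hga : ∀ (b : Bool) (y : Fin m → Bool), g (Fin.cons b y) = halfSum g y := by
        intro b y; rw [apply_cons_eq g b y, hb y, mul_zero, add_zero]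
      have ha : ∃ y, halfSum g y ≠ 0 := by
        obtain ⟨x, hx⟩ := hne
        refine ⟨Fin.tail x, ?_⟩
        rw [← hga (x 0), Fin.cons_self_tail]; exact hx
      have hih := ih e (halfSum g) (isLevelLE_halfSum hg) ha
      have hsum : supportCount g = 2 * supportCount (halfSum g) := by
        rw [supportCount_succ]
        unfold supportCount
        rw [mul_sum]
        refine sum_congr rfl fun y _ => ?_
        rw [hga, hga]; ring
      rw [pow_succ, hsum]
      nlinarith

/-! ### §2 Influences of a low-degree Boolean function -/

/-- The derivative `D_i f` of a degree-`≤ d` function has degree `≤ d − 1`.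
[cite: ODonnell2014, Prop. 2.19 ((D_i f)^(U) = f̂(U ∪ {i}))] -/
theorem isLevelLE_coordDeriv {d : ℕ} {f : (Fin m → Bool) → ℝ} (hf : IsLevelLE d f) (i : Fin m) :
    IsLevelLE (d - 1) (KKL.coordDeriv i f) := by
  intro U hU
  rw [KKL.cubeFourierCoeff_coordDeriv]
  split_ifs with hi
  · rfl
  · exact hf _ (by rw [card_insert_of_notMem hi]; omega)

/-- Zero influence means `f(x) = f(x^{⊕i})` for every `x`. [cite: ODonnell2014, Def. 2.13 (Inf_i = Pr[f(x) ≠ f(x^{⊕i})])] -/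
theorem apply_eq_of_influence_eq_zero {f : (Fin m → Bool) → ℝ} {i : Fin m}
    (h : KKL.influence i f = 0) (x : Fin m → Bool) : f x = f (Function.update x i (!x i)) := by
  unfold KKL.influence at h
  rw [div_eq_zero_iff] at h
  rcases h with h | h
  · have := (sum_eq_zero_iff_of_nonneg (fun x _ => by split_ifs <;> norm_num)).1 h x (mem_univ x)
    by_contra hne
    rw [if_pos hne] at this
    exact one_ne_zero this
  · exact absurd h (by positivity)

/-- **Each relevant coordinate of a degree-`d` Boolean function has influence `≥ 2^{−(d−1)}`**
(Schwartz–Zippel for `D_i f ∈ {−1,0,1}`, nonzero, of degree `≤ d − 1`).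
[cite: ChiarelliHatamiSaks2018, §1 (p0003, "each relevant variable has individual influence at least 2^{−(d−1)}")] -/
theorem influence_ge_of_isLevelLE (f : (Fin m → Bool) → ℝ) (hf : ∀ x, f x = 1 ∨ f x = -1) {d : ℕ}
    (hd : IsLevelLE d f) {i : Fin m} (hi : KKL.influence i f ≠ 0) :
    (1 / 2 : ℝ) ^ (d - 1) ≤ KKL.influence i f := by
  -- `Inf_i[f] = |{x : D_i f x ≠ 0}| / 2^m`
  have hind : ∀ x, (if f x ≠ f (Function.update x i (!x i)) then (1 : ℝ) else 0) =
      if KKL.coordDeriv i f x ≠ 0 then (1 : ℝ) else 0 := by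
    intro x
    have hsq := KKL.coordDeriv_sq_eq_ite f hf i x
    by_cases h : f x ≠ f (Function.update x i (!x i))
    · rw [if_pos h] at hsq ⊢
      have : KKL.coordDeriv i f x ≠ 0 := fun h0 => by rw [h0] at hsq; norm_num at hsq
      rw [if_pos this]
    · rw [if_neg h] at hsq ⊢
      have : KKL.coordDeriv i f x = 0 := pow_eq_zero_iff two_ne_zero |>.1 hsq
      rw [if_neg (not_not.2 this)]
  have hInf : KKL.influence i f = supportCount (KKL.coordDeriv i f) / 2 ^ m := by
    unfold KKL.influence supportCount
    rw [sum_congr rfl fun x _ => hind x]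
  have hne : ∃ x, KKL.coordDeriv i f x ≠ 0 := by
    by_contra h
    push Not at h
    apply hi
    rw [hInf]
    unfold supportCount
    rw [sum_eq_zero fun x _ => by rw [if_neg (not_not.2 (h x))], zero_div]
  have hSZ := two_pow_le_card_support (d - 1) (KKL.coordDeriv i f) (isLevelLE_coordDeriv hd i) hne
  have h2m : (0 : ℝ) < 2 ^ m := by positivity
  rw [hInf, le_div_iff₀ h2m]
  have hhalf : (0 : ℝ) ≤ (1 / 2 : ℝ) ^ (d - 1) := by positivity
  have hpow : (1 / 2 : ℝ) ^ (d - 1) * 2 ^ (d - 1) = 1 := by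
    rw [one_div_pow, one_div, inv_mul_cancel₀ (by positivity)]
  calc (1 / 2 : ℝ) ^ (d - 1) * 2 ^ m
      ≤ (1 / 2 : ℝ) ^ (d - 1) * (2 ^ (d - 1) * supportCount (KKL.coordDeriv i f)) :=
        mul_le_mul_of_nonneg_left hSZ hhalf
    _ = supportCount (KKL.coordDeriv i f) := by rw [← mul_assoc, hpow, one_mul]

/-- **Total influence of a degree-`d` Boolean function is at most `d`**:
`I[f] = Σ_S |S| f̂(S)² ≤ d Σ_S f̂(S)² = d`. [cite: ChiarelliHatamiSaks2018, §1 (p0003, "every degree d Boolean function has total influence bounded by d")] -/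
theorem totalInfluence_le_degree (f : (Fin m → Bool) → ℝ) (hf : ∀ x, f x = 1 ∨ f x = -1) {d : ℕ}
    (hd : IsLevelLE d f) : KKL.totalInfluence f ≤ d := by
  rw [KKL.totalInfluence_eq_sum f hf]
  have hP : ∑ S : Finset (Fin m), cubeFourierCoeff f S ^ 2 = 1 := by
    rw [sum_cubeFourierCoeff_sq]
    have : ∀ x, f x ^ 2 = 1 := fun x => by rcases hf x with h | h <;> rw [h] <;> norm_num
    rw [sum_congr rfl fun x _ => this x, sum_const, card_univ, Fintype.card_fun, Fintype.card_bool,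
      Fintype.card_fin, nsmul_eq_mul, mul_one]
    push_cast
    exact div_self (by positivity)
  calc ∑ S : Finset (Fin m), (S.card : ℝ) * cubeFourierCoeff f S ^ 2
      ≤ ∑ S : Finset (Fin m), (d : ℝ) * cubeFourierCoeff f S ^ 2 := by
        refine sum_le_sum fun S _ => ?_
        by_cases hS : d < S.card
        · rw [hd S hS]; simp
        · exact mul_le_mul_of_nonneg_right (by exact_mod_cast not_lt.1 hS) (sq_nonneg _)
    _ = d := by rw [← mul_sum, hP, mul_one]

/-! ### §3 The theorem -/

/-- **At most `d·2^{d−1}` coordinates are relevant** (have nonzero influence) for a `±1`-valued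
function of degree `≤ d`: `|R| · 2^{−(d−1)} ≤ Σ_{i ∈ R} Inf_i ≤ I[f] ≤ d`.
[cite: NisanSzegedy1994, main junta bound R(f) ≤ deg(f)·2^{deg(f)−1} (as restated in ChiarelliHatamiSaks2018 §1, p. 3)]
[cite: ChiarelliHatamiSaks2018, §1 (p0003)] -/
theorem card_relevant_le (f : (Fin m → Bool) → ℝ) (hf : ∀ x, f x = 1 ∨ f x = -1) {d : ℕ}
    (hd : IsLevelLE d f) :
    ((univ.filter fun i : Fin m => KKL.influence i f ≠ 0).card : ℝ) ≤ (d : ℝ) * 2 ^ (d - 1) := by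
  set R := univ.filter fun i : Fin m => KKL.influence i f ≠ 0 with hR
  have h1 : (R.card : ℝ) * (1 / 2 : ℝ) ^ (d - 1) ≤ ∑ i ∈ R, KKL.influence i f := by
    rw [← nsmul_eq_mul, ← sum_const]
    exact sum_le_sum fun i hi => influence_ge_of_isLevelLE f hf hd (mem_filter.1 hi).2
  have h2 : ∑ i ∈ R, KKL.influence i f ≤ KKL.totalInfluence f := by
    unfold KKL.totalInfluence
    exact sum_le_sum_of_subset_of_nonneg (filter_subset _ _) fun i _ _ => KKL.influence_nonneg i f
  have h3 := totalInfluence_le_degree f hf hd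
  have hpow : (1 / 2 : ℝ) ^ (d - 1) * 2 ^ (d - 1) = 1 := by
    rw [one_div_pow, one_div, inv_mul_cancel₀ (by positivity)]
  have hpos : (0 : ℝ) < 2 ^ (d - 1) := by positivity
  calc (R.card : ℝ) = (R.card : ℝ) * (1 / 2 : ℝ) ^ (d - 1) * 2 ^ (d - 1) := by
        rw [mul_assoc, hpow, mul_one]
    _ ≤ (d : ℝ) * 2 ^ (d - 1) := by
        have := mul_le_mul_of_nonneg_right (le_trans (le_trans h1 h2) h3) hpos.le
        linarith

/-- **A function depends only on its coordinates of nonzero influence**: if `x` and `y` agree on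
every coordinate of nonzero influence then `f(x) = f(y)` (flip the remaining coordinates one at a
time). [cite: ChiarelliHatamiSaks2018, §1 (p0003, "f is a J-junta if … for all i ∉ J, f(x) = f(x^i)")] -/
theorem eq_of_agree_on_relevant (f : (Fin m → Bool) → ℝ) :
    ∀ x y : Fin m → Bool, (∀ i, KKL.influence i f ≠ 0 → x i = y i) → f x = f y := by
  -- induction on the number of coordinates where `x` and `y` differ
  suffices h : ∀ (n : ℕ) (x y : Fin m → Bool), (univ.filter fun i => x i ≠ y i).card = n →
      (∀ i, KKL.influence i f ≠ 0 → x i = y i) → f x = f y from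
    fun x y hxy => h _ x y rfl hxy
  intro n
  induction n with
  | zero =>
    intro x y hcard _
    have : x = y := by
      funext i
      by_contra hne
      have : i ∈ univ.filter fun i => x i ≠ y i := mem_filter.2 ⟨mem_univ i, hne⟩
      rw [card_eq_zero.1 hcard] at this
      exact notMem_empty i this
    rw [this]
  | succ n ih =>
    intro x y hcard hagree
    obtain ⟨i, hi⟩ : (univ.filter fun i => x i ≠ y i).Nonempty := by
      rw [← card_pos, hcard]; exact Nat.succ_pos n
    have hxi : x i ≠ y i := (mem_filter.1 hi).2
    have hInf : KKL.influence i f = 0 := by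
      by_contra h; exact hxi (hagree i h)
    -- flip coordinate `i` of `x`
    set x' := Function.update x i (!x i) with hx'
    have hyi : y i = !x i := by
      cases hx : x i <;> cases hy : y i <;> simp_all
    have hstep : f x = f x' := apply_eq_of_influence_eq_zero hInf x
    have hcard' : (univ.filter fun j => x' j ≠ y j).card = n := by
      have hset : (univ.filter fun j => x' j ≠ y j) = (univ.filter fun j => x j ≠ y j).erase i := by
        ext j
        simp only [mem_filter, mem_univ, true_and, mem_erase]
        by_cases hj : j = i
        · subst hj; rw [hx', Function.update_self, hyi]; simp
        · rw [hx', Function.update_of_ne hj]; exact ⟨fun h => ⟨hj, h⟩, fun h => h.2⟩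
      rw [hset, card_erase_of_mem hi, hcard]; rfl
    have hagree' : ∀ j, KKL.influence j f ≠ 0 → x' j = y j := by
      intro j hj
      by_cases hji : j = i
      · subst hji; exact absurd hInf hj
      · rw [hx', Function.update_of_ne hji]; exact hagree j hj
    rw [hstep]
    exact ih x' y hcard' hagree'

/-- **The Nisan–Szegedy theorem** [NisanSzegedy1994]: a `±1`-valued function on `{0,1}^m` of degree
`≤ d` (`f̂(S) = 0` for `|S| > d`) is a `d·2^{d−1}`-junta — there is a set `J` of at most `d·2^{d−1}`
coordinates such that `f(x) = f(y)` whenever `x` and `y` agree on `J` ("Nisan and Szegedy proved that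
`R(f)` is at most `deg(f)·2^{deg(f)−1}`"). `J` = the coordinates of nonzero influence.
[cite: NisanSzegedy1994, main junta bound R(f) ≤ deg(f)·2^{deg(f)−1} (as restated in ChiarelliHatamiSaks2018 §1, p. 3)]
[cite: ChiarelliHatamiSaks2018, §1 (p0003)] -/
theorem nisanSzegedy_junta (f : (Fin m → Bool) → ℝ) (hf : ∀ x, f x = 1 ∨ f x = -1) {d : ℕ}
    (hd : IsLevelLE d f) :
    ∃ J : Finset (Fin m), (J.card : ℝ) ≤ (d : ℝ) * 2 ^ (d - 1) ∧
      ∀ x y : Fin m → Bool, (∀ i ∈ J, x i = y i) → f x = f y :=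
  ⟨univ.filter fun i => KKL.influence i f ≠ 0, card_relevant_le f hf hd,
    fun x y hxy => eq_of_agree_on_relevant f x y fun i hi => hxy i (mem_filter.2 ⟨mem_univ i, hi⟩)⟩

end NisanSzegedy

end Literature.Computability.Complexity.LowDegree
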